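import Mathlib.Analysis.Calculus.MeanValue
import Mathlib.Analysis.Complex.ExponentialBounds
import Mathlib.MeasureTheory.Group.Integral
import Mathlib.MeasureTheory.Integral.IntervalIntegral.FundThmCalculus
import Summits.RiemannHypothesis.RiemannHypothesis.Theorems.WeilCombCombShapePositivityBumpAutocorrDeriv

/-!
# Lipschitz constant of the derivative of the bump autocorrelation
(crux `WeilComb.CombShapePositivity`, item stmt-RiemannHypothesis-11229, line `Sketch`, towards `stub_windowCore`:
brick B0b, an analytic input of the interval certificate of the diagonal constant `𝒞' = ∫₀² (N − P₀(s))/s ds`)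

Notation. `φ₀(u) = expNegInvGlue (1 - u²)` is the fixed bump (`= e^{-1/(1-u²)}` on `(-1, 1)`, `0` outside),
`ψ(v) = (2v/(1-v²)²)·φ₀(v)` (`= -φ₀'(v)`; continuous, odd, supported in `[-1, 1]`), and
`D(s) = ∫ φ₀(u) ψ(u − s) du`, written inline. (`D` is the derivative of the autocorrelation
`P₀(s) = ∫ φ₀(u) φ₀(u − s) du`, but this file never differentiates under the integral sign: everything here is
about the explicit integral `D`.)

Main result `stub_bumpAutocorr_deriv_lipschitz`: `|D(s) − D(s')| ≤ (4/5)|s − s'|` for all real `s, s'`.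

Route (elementary):
* `hasDerivAt_shapeBump_bumpLip`: `φ₀' = -ψ` at every real point (chain rule with the global formula
  `expNegInvGlue' (x) = expNegInvGlue x / x²`, `hasDerivAt_expNegInvGlue_bumpAD` of `…BumpAutocorrDeriv.lean`, which
  also supplies continuity and compact support of `ψ`: `continuous_bumpDeriv_bumpAD`, `hasCompactSupport_bumpDeriv_bumpAD`);
* `abs_bumpDeriv_le_bumpLip`: `|ψ| ≤ 8/e²` (with `t = (1-v²)⁻¹`, `|ψ| = 2|v| t² e^{-t}` and `t² e^{-t} ≤ 4e^{-2}`
  from `1 + y ≤ e^y` at `y = t/2 - 1`), so `φ₀` is `8/e²`-Lipschitz (mean value inequality);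
* `integral_abs_bumpDeriv_bumpLip`: `∫ |ψ| = 2/e` exactly (fundamental theorem of calculus on `[-1, 0]` and
  `[0, 1]`, `φ₀(0) = e⁻¹`, `φ₀(±1) = 0`);
* translation invariance `D(s) = ∫ φ₀(w + s) ψ(w) dw`, so
  `|D(s) − D(s')| ≤ ∫ |φ₀(w+s) − φ₀(w+s')| |ψ(w)| dw ≤ (8/e²)|s − s'|·(2/e) = (16/e³)|s − s'|`,
  and `16/e³ ≤ 4/5` from `Real.exp_neg_one_lt_d9` (`16 · 0.3678794412³ < 0.7966`).
-/

noncomputable section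

-- the sub-problem path RiemannHypothesis/RiemannHypothesis duplicates a namespace (D-0017)
set_option linter.dupNamespace false

open MeasureTheory Set intervalIntegral

namespace Summit.RiemannHypothesis.RiemannHypothesis.Theorems.WeilCombBohrFejer

/-! ### The derivative of the bump: `φ₀' = -ψ`, `ψ(v) = 2v/(1-v²)² · φ₀(v)` -/

/-- `φ₀'(v) = -(2v/(1-v²)²) φ₀(v)` at every real `v` (chain rule with `expNegInvGlue' (x) = expNegInvGlue x / x²`,
valid globally: both sides vanish for `v² ≥ 1`, using `x/0 = 0`). [folklore] -/
theorem hasDerivAt_shapeBump_bumpLip (v : ℝ) :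
    HasDerivAt (fun u : ℝ => expNegInvGlue (1 - u ^ 2))
      (-(2 * v / (1 - v ^ 2) ^ 2 * expNegInvGlue (1 - v ^ 2))) v := by
  have h1 : HasDerivAt (fun u : ℝ => 1 - u ^ 2) (-(2 * v)) v := by
    simpa using (hasDerivAt_pow 2 v).const_sub 1
  refine ((hasDerivAt_expNegInvGlue_bumpAD (1 - v ^ 2)).comp v h1).congr_deriv ?_
  ring

-- continuity and compact support of `ψ` are `continuous_bumpDeriv_bumpAD`, `hasCompactSupport_bumpDeriv_bumpAD`
-- (`…BumpAutocorrDeriv.lean`, reused).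

/-! ### The sup bound `|ψ| ≤ 8/e²` and the Lipschitz bound for `φ₀` -/

/-- `t² e^{-t} ≤ 4 e^{-2}` for `t ≥ 0` (square `t/2 ≤ e^{t/2 - 1}`, i.e. `1 + y ≤ e^y` at `y = t/2 - 1`).
[folklore] -/
theorem sq_mul_exp_neg_le_bumpLip {t : ℝ} (ht : 0 ≤ t) : t ^ 2 * Real.exp (-t) ≤ 4 * Real.exp (-2) := by
  have h1 : t / 2 ≤ Real.exp (t / 2 - 1) := by linarith [Real.add_one_le_exp (t / 2 - 1)]
  have ht2 : 0 ≤ t / 2 := by linarith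
  calc t ^ 2 * Real.exp (-t) = (t / 2) ^ 2 * 4 * Real.exp (-t) := by ring
    _ ≤ Real.exp (t / 2 - 1) ^ 2 * 4 * Real.exp (-t) := by gcongr
    _ = 4 * Real.exp ((t / 2 - 1) + (t / 2 - 1) + -t) := by rw [Real.exp_add, Real.exp_add]; ring
    _ = 4 * Real.exp (-2) := by congr 1; ring

/-- `|ψ(v)| ≤ 8/e²` for every real `v` (`|ψ| = 2|v| t² e^{-t}` with `t = (1-v²)⁻¹` when `v² < 1`, else `ψ = 0`).
[folklore] -/
theorem abs_bumpDeriv_le_bumpLip (v : ℝ) :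
    |2 * v / (1 - v ^ 2) ^ 2 * expNegInvGlue (1 - v ^ 2)| ≤ 8 * Real.exp (-2) := by
  rcases le_or_gt 1 (v ^ 2) with hv | hv
  · rw [expNegInvGlue.zero_of_nonpos (sub_nonpos.2 hv), mul_zero, abs_zero]
    positivity
  · have hx : 0 < 1 - v ^ 2 := sub_pos.2 hv
    have hav : |v| ≤ 1 := ((sq_lt_one_iff_abs_lt_one v).1 hv).le
    have key : (1 - v ^ 2)⁻¹ ^ 2 * Real.exp (-(1 - v ^ 2)⁻¹) ≤ 4 * Real.exp (-2) :=
      sq_mul_exp_neg_le_bumpLip (inv_nonneg.2 hx.le)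
    rw [expNegInvGlue_one_sub_sq hv, abs_mul, abs_of_pos (Real.exp_pos _), abs_div, abs_mul, abs_two,
      abs_of_pos (pow_pos hx 2)]
    calc 2 * |v| / (1 - v ^ 2) ^ 2 * Real.exp (-(1 - v ^ 2)⁻¹)
        = 2 * |v| * ((1 - v ^ 2)⁻¹ ^ 2 * Real.exp (-(1 - v ^ 2)⁻¹)) := by rw [inv_pow]; ring
      _ ≤ 2 * 1 * (4 * Real.exp (-2)) := by gcongr
      _ = 8 * Real.exp (-2) := by ring

/-- The bump `φ₀` is `8/e²`-Lipschitz (mean value inequality with `|φ₀'| = |ψ| ≤ 8/e²`). [folklore] -/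
theorem abs_shapeBump_sub_le_bumpLip (a b : ℝ) :
    |expNegInvGlue (1 - a ^ 2) - expNegInvGlue (1 - b ^ 2)| ≤ 8 * Real.exp (-2) * |a - b| := by
  have h := Convex.norm_image_sub_le_of_norm_hasDerivWithin_le
    (f := fun u : ℝ => expNegInvGlue (1 - u ^ 2)) (s := Set.univ) (x := b) (y := a)
    (fun x _ => (hasDerivAt_shapeBump_bumpLip x).hasDerivWithinAt)
    (fun x _ => by rw [norm_neg, Real.norm_eq_abs]; exact abs_bumpDeriv_le_bumpLip x)
    convex_univ (mem_univ b) (mem_univ a)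
  simpa only [Real.norm_eq_abs] using h

/-! ### `∫ |ψ| = 2/e` -/

/-- `φ₀(0) = e⁻¹`. [folklore] -/
theorem shapeBump_zero_bumpLip : expNegInvGlue (1 - (0 : ℝ) ^ 2) = Real.exp (-1) := by
  rw [expNegInvGlue_one_sub_sq (by norm_num)]
  norm_num

/-- `∫₀¹ |ψ| = e⁻¹` (on `[0, 1]`, `|ψ| = ψ = (-φ₀)'`, and `φ₀(0) - φ₀(1) = e⁻¹ - 0`). [folklore] -/
theorem integral_abs_bumpDeriv_right_bumpLip :
    ∫ v in (0 : ℝ)..1, |2 * v / (1 - v ^ 2) ^ 2 * expNegInvGlue (1 - v ^ 2)| = Real.exp (-1) := by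
  have h1 : ∫ v in (0 : ℝ)..1, |2 * v / (1 - v ^ 2) ^ 2 * expNegInvGlue (1 - v ^ 2)| =
      ∫ v in (0 : ℝ)..1, 2 * v / (1 - v ^ 2) ^ 2 * expNegInvGlue (1 - v ^ 2) := by
    refine integral_congr fun v hv => ?_
    rw [uIcc_of_le zero_le_one, mem_Icc] at hv
    exact abs_of_nonneg (mul_nonneg (div_nonneg (by linarith) (sq_nonneg _)) (expNegInvGlue.nonneg _))
  have h2 : ∫ v in (0 : ℝ)..1, 2 * v / (1 - v ^ 2) ^ 2 * expNegInvGlue (1 - v ^ 2) =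
      (-expNegInvGlue (1 - (1 : ℝ) ^ 2)) - (-expNegInvGlue (1 - (0 : ℝ) ^ 2)) := by
    apply integral_eq_sub_of_hasDerivAt (f := fun u : ℝ => -expNegInvGlue (1 - u ^ 2))
    · intro x _
      simpa only [neg_neg] using (hasDerivAt_shapeBump_bumpLip x).fun_neg
    · exact continuous_bumpDeriv_bumpAD.intervalIntegrable _ _
  rw [h1, h2, shapeBump_zero_bumpLip]
  norm_num [expNegInvGlue.zero]

/-- `∫₋₁⁰ |ψ| = e⁻¹` (on `[-1, 0]`, `|ψ| = -ψ = φ₀'`, and `φ₀(0) - φ₀(-1) = e⁻¹ - 0`). [folklore] -/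
theorem integral_abs_bumpDeriv_left_bumpLip :
    ∫ v in (-1 : ℝ)..0, |2 * v / (1 - v ^ 2) ^ 2 * expNegInvGlue (1 - v ^ 2)| = Real.exp (-1) := by
  have h1 : ∫ v in (-1 : ℝ)..0, |2 * v / (1 - v ^ 2) ^ 2 * expNegInvGlue (1 - v ^ 2)| =
      ∫ v in (-1 : ℝ)..0, -(2 * v / (1 - v ^ 2) ^ 2 * expNegInvGlue (1 - v ^ 2)) := by
    refine integral_congr fun v hv => ?_
    rw [uIcc_of_le (by norm_num), mem_Icc] at hv
    refine abs_of_nonpos (mul_nonpos_of_nonpos_of_nonneg ?_ (expNegInvGlue.nonneg _))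
    exact div_nonpos_of_nonpos_of_nonneg (by linarith) (sq_nonneg _)
  have h2 : ∫ v in (-1 : ℝ)..0, -(2 * v / (1 - v ^ 2) ^ 2 * expNegInvGlue (1 - v ^ 2)) =
      expNegInvGlue (1 - (0 : ℝ) ^ 2) - expNegInvGlue (1 - (-1 : ℝ) ^ 2) := by
    apply integral_eq_sub_of_hasDerivAt (f := fun u : ℝ => expNegInvGlue (1 - u ^ 2))
    · intro x _
      exact hasDerivAt_shapeBump_bumpLip x
    · exact continuous_bumpDeriv_bumpAD.neg.intervalIntegrable _ _
  rw [h1, h2, shapeBump_zero_bumpLip]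
  norm_num [expNegInvGlue.zero]

/-- `∫ |ψ| = 2/e` (`ψ` vanishes off `(-1, 1)`). [folklore] -/
theorem integral_abs_bumpDeriv_bumpLip :
    ∫ v, |2 * v / (1 - v ^ 2) ^ 2 * expNegInvGlue (1 - v ^ 2)| = 2 * Real.exp (-1) := by
  have hsupp : Function.support (fun v : ℝ => |2 * v / (1 - v ^ 2) ^ 2 * expNegInvGlue (1 - v ^ 2)|) ⊆
      Ioc (-1) 1 := by
    intro v hv
    rw [Function.mem_support, ne_eq, abs_eq_zero, mul_eq_zero, not_or] at hv
    have h := hv.2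
    rw [expNegInvGlue.zero_iff_nonpos, not_le, sub_pos, sq_lt_one_iff_abs_lt_one] at h
    exact ⟨(abs_lt.1 h).1, (abs_lt.1 h).2.le⟩
  have hii : ∀ a b : ℝ, IntervalIntegrable
      (fun v : ℝ => |2 * v / (1 - v ^ 2) ^ 2 * expNegInvGlue (1 - v ^ 2)|) volume a b :=
    fun a b => continuous_bumpDeriv_bumpAD.abs.intervalIntegrable a b
  rw [← integral_eq_integral_of_support_subset hsupp, ← integral_add_adjacent_intervals (hii (-1) 0) (hii 0 1),
    integral_abs_bumpDeriv_left_bumpLip, integral_abs_bumpDeriv_right_bumpLip]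
  ring

/-! ### Assembly -/

/-- Translation invariance: `D(s) = ∫ φ₀(w + s) ψ(w) dw`. [folklore] -/
theorem bumpAutocorrDeriv_eq_shift_bumpLip (s : ℝ) :
    ∫ u : ℝ, expNegInvGlue (1 - u ^ 2) *
        (2 * (u - s) / (1 - (u - s) ^ 2) ^ 2 * expNegInvGlue (1 - (u - s) ^ 2)) =
      ∫ w : ℝ, expNegInvGlue (1 - (w + s) ^ 2) * (2 * w / (1 - w ^ 2) ^ 2 * expNegInvGlue (1 - w ^ 2)) := by
  have h := integral_add_right_eq_self (μ := (volume : Measure ℝ))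
    (fun u : ℝ => expNegInvGlue (1 - u ^ 2) *
      (2 * (u - s) / (1 - (u - s) ^ 2) ^ 2 * expNegInvGlue (1 - (u - s) ^ 2))) s
  simp only [add_sub_cancel_right] at h
  exact h.symm

/-- `w ↦ φ₀(w + s) ψ(w)` is integrable (continuous with compact support). [folklore] -/
theorem integrable_shift_mul_bumpDeriv_bumpLip (s : ℝ) :
    Integrable fun w : ℝ =>
      expNegInvGlue (1 - (w + s) ^ 2) * (2 * w / (1 - w ^ 2) ^ 2 * expNegInvGlue (1 - w ^ 2)) :=
  ((continuous_shapeBump.comp (continuous_id.add continuous_const)).mul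
      continuous_bumpDeriv_bumpAD).integrable_of_hasCompactSupport
    hasCompactSupport_bumpDeriv_bumpAD.mul_left

/-- The numerical margin: `(8/e²)·(2/e) = 16/e³ ≤ 4/5` (`e⁻¹ < 0.3678794412`, `16 · 0.3678794412³ < 0.7966`).
[folklore] -/
theorem lipschitzConst_le_bumpLip : 8 * Real.exp (-2) * (2 * Real.exp (-1)) ≤ 4 / 5 := by
  have h1 : Real.exp (-1) < 0.3678794412 := Real.exp_neg_one_lt_d9
  have h0 : 0 < Real.exp (-1) := Real.exp_pos _
  have h2 : Real.exp (-2) = Real.exp (-1) ^ 2 := by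
    rw [sq, ← Real.exp_add]
    norm_num
  have h3 : Real.exp (-1) ^ 3 < 0.3678794412 ^ 3 := pow_lt_pow_left₀ h1 h0.le three_ne_zero
  rw [h2]
  nlinarith [h3]

/-- **B0b input (Lipschitz constant of `D = P₀'`).** With `φ₀(u) = expNegInvGlue (1 − u²)` and
`ψ(v) = (2v/(1−v²)²)·φ₀(v)`, the function `D(s) = ∫ φ₀(u) ψ(u − s) du` satisfies
`|D(s) − D(s')| ≤ (4/5)|s − s'|` for all real `s, s'` (in fact with the constant `16/e³ = 0.7965…`). [folklore] -/
theorem stub_bumpAutocorr_deriv_lipschitz : ∀ s s' : ℝ,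
    |(∫ u : ℝ, expNegInvGlue (1 - u ^ 2) *
        (2 * (u - s) / (1 - (u - s) ^ 2) ^ 2 * expNegInvGlue (1 - (u - s) ^ 2))) -
      ∫ u : ℝ, expNegInvGlue (1 - u ^ 2) *
        (2 * (u - s') / (1 - (u - s') ^ 2) ^ 2 * expNegInvGlue (1 - (u - s') ^ 2))| ≤
      4 / 5 * |s - s'| := by
  intro s s'
  rw [bumpAutocorrDeriv_eq_shift_bumpLip s, bumpAutocorrDeriv_eq_shift_bumpLip s',
    ← integral_sub (integrable_shift_mul_bumpDeriv_bumpLip s) (integrable_shift_mul_bumpDeriv_bumpLip s')]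
  have hI : Integrable fun w : ℝ =>
      8 * Real.exp (-2) * |s - s'| * |2 * w / (1 - w ^ 2) ^ 2 * expNegInvGlue (1 - w ^ 2)| :=
    (continuous_bumpDeriv_bumpAD.integrable_of_hasCompactSupport
      hasCompactSupport_bumpDeriv_bumpAD).abs.const_mul _
  calc |∫ w, (expNegInvGlue (1 - (w + s) ^ 2) * (2 * w / (1 - w ^ 2) ^ 2 * expNegInvGlue (1 - w ^ 2)) -
          expNegInvGlue (1 - (w + s') ^ 2) * (2 * w / (1 - w ^ 2) ^ 2 * expNegInvGlue (1 - w ^ 2)))|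
      ≤ ∫ w, |expNegInvGlue (1 - (w + s) ^ 2) * (2 * w / (1 - w ^ 2) ^ 2 * expNegInvGlue (1 - w ^ 2)) -
          expNegInvGlue (1 - (w + s') ^ 2) * (2 * w / (1 - w ^ 2) ^ 2 * expNegInvGlue (1 - w ^ 2))| :=
        abs_integral_le_integral_abs
    _ ≤ ∫ w, 8 * Real.exp (-2) * |s - s'| * |2 * w / (1 - w ^ 2) ^ 2 * expNegInvGlue (1 - w ^ 2)| := by
        refine integral_mono_of_nonneg (Filter.Eventually.of_forall fun w => abs_nonneg _) hI
          (Filter.Eventually.of_forall fun w => ?_)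
        dsimp only
        rw [← sub_mul, abs_mul]
        refine mul_le_mul_of_nonneg_right ?_ (abs_nonneg _)
        have h := abs_shapeBump_sub_le_bumpLip (w + s) (w + s')
        rwa [add_sub_add_left_eq_sub] at h
    _ = 8 * Real.exp (-2) * |s - s'| * (2 * Real.exp (-1)) := by
        rw [MeasureTheory.integral_const_mul, integral_abs_bumpDeriv_bumpLip]
    _ = 8 * Real.exp (-2) * (2 * Real.exp (-1)) * |s - s'| := by ring
    _ ≤ 4 / 5 * |s - s'| := mul_le_mul_of_nonneg_right lipschitzConst_le_bumpLip (abs_nonneg _)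

end Summit.RiemannHypothesis.RiemannHypothesis.Theorems.WeilCombBohrFejer

end
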